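import Mathlib
import Summits.MatrixMultiplication.MatrixMultiplication.Theorems.SnSubsetDichotomyPolynomialSlackHubAtomsArith
import Summits.MatrixMultiplication.MatrixMultiplication.Theorems.SnSubsetDichotomyPolynomialSlackPositionKeptBoundInst
import Summits.MatrixMultiplication.MatrixMultiplication.Theorems.SnSubsetDichotomyPolynomialSlackPositionRates
import Summits.MatrixMultiplication.MatrixMultiplication.Theorems.SnSubsetDichotomyPolynomialSlackHubAtomsPrep
import Summits.MatrixMultiplication.MatrixMultiplication.Theorems.SnSubsetDichotomyPolynomialSlackCertificateLevels
import Summits.MatrixMultiplication.MatrixMultiplication.Theorems.SnSubsetDichotomyPolynomialSlackTripleSumByPosition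
import Summits.MatrixMultiplication.MatrixMultiplication.Theorems.SnSubsetDichotomyPolynomialSlackStubSplit
import Summits.MatrixMultiplication.MatrixMultiplication.Theorems.SnSubsetDichotomyPolynomialSlackDyadicLevels

/-!
# The atoms theorem (`volume_le_of_hub_atoms`)

Programme B of the crux `PolynomialSlack` (line `transport-split-hull`): in the split `(B, C)`
regime, an almost fully kept level-one mass (`1 - δ ≤ kept`) with heavy masses `≤ Λ` and the
co-density cap `log (K_B K_C) ≤ 1.34 log n` forces a win: `N ≤ polylog · n^{1.49} · B`.
The proof sums the per-position inequality `position_kept_bound_inst` over the positions,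
evaluates the level costs with the entropy certificate `certificate_levels` on both sparse
sides, and closes with the arithmetic of `hubAtoms_endgame`.
-/

namespace Summit.MatrixMultiplication.MatrixMultiplication.Theorems.PolynomialSlack

open scoped BigOperators
open Literature.Combinatorics.Additive (TripleProductProperty)

set_option linter.dupNamespace false


set_option maxHeartbeats 400000 in
/-- **The atoms theorem** (programme B, stub HA2 of line `transport-split-hull`): in the split
`(B, C)` regime with heavy masses `≤ Λ`, an almost fully kept level-one mass and the co-density
cap `log (K_B K_C) ≤ 1.34 log n` (plus the polylogarithmic ranges `E1, E3, E4, E5`) force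
`N ≤ 2·10³⁵ Λ⁶ G⁸ log²(8000 Λ K_A) · n^(149/100) · B`. -/
theorem volume_le_of_hub_atoms {n : ℕ} (hn : 40 ≤ n) (B : ℕ) (hB : ∀ S' T' U' : Finset (Equiv.Perm (Fin (n - 1))), TripleProductProperty S' T' U' → S'.card * T'.card * U'.card ≤ B) {S T U : Finset (Equiv.Perm (Fin n))} (hTPP : TripleProductProperty S T U) (hS0 : S.Nonempty) (hT0 : T.Nonempty) (hU0 : U.Nonempty) (dA dB dC pB pC : Fin n → Fin n → ℝ) (hdA : ∀ i j, dA i j = (((S ×ˢ T).filter fun st => st.2 j = st.1 i).card : ℝ) / (S.card * T.card : ℕ)) (hdB : ∀ j k, dB j k = (((T ×ˢ U).filter fun tu => tu.2 k = tu.1 j).card : ℝ) / (T.card * U.card : ℕ)) (hdC : ∀ k i, dC k i = (((U ×ˢ S).filter fun us => us.2 i = us.1 k).card : ℝ) / (U.card * S.card : ℕ)) (θB θC Λ δ : ℝ) (hθB : 16 / (n : ℝ) ≤ θB) (hθC : 16 / (n : ℝ) ≤ θC) (hpB : ∀ j k, pB j k = if θB ≤ dB j k then dB j k - 1 / n else 0)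 (hpC : ∀ k i, pC k i = if θC ≤ dC k i then dC k i - 1 / n else 0) (hΛ : 1 ≤ Λ) (hδ : δ ≤ 1 / 1000) (hmassB : ∑ j : Fin n, ∑ k : Fin n, (if θB ≤ dB j k then dB j k else 0) ≤ Λ) (hmassC : ∑ k : Fin n, ∑ i : Fin n, (if θC ≤ dC k i then dC k i else 0) ≤ Λ) (hkept : 1 - δ ≤ -((n : ℝ) - 1) * ∑ i : Fin n, ∑ j : Fin n, ∑ k : Fin n, (dA i j - 1 / n) * pB j k * pC k i) (hQ : Real.log (((n.factorial : ℝ) / (T.card * U.card : ℕ)) * ((n.factorial : ℝ) / (U.card * S.card : ℕ))) ≤ 134 / 100 * Real.log n) (hE1 : Real.log (2 * 10 ^ 10 * Λ ^ 2 * n * (1 + Real.log n) * Real.log (8000 * Λ * ((n.factorial : ℝ) / (S.card * T.card : ℕ)))) ≤ 101 / 100 * Real.log n) (hE3 : 8 * 10 ^ 8 * Λ ^ 4 * (1 + Real.log n) ^ 2 ≤ (n : ℝ)) (hE4 : 16 * Real.log (160000 * Λ * (1 + Real.log n)) + 4 ≤ 5 / 1000 * Real.log n) (hE5 : Real.log (40000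 * Λ ^ 2 * (1 + Real.log n)) ≤ 45 / 1000 * Real.log n) : ((S.card * T.card * U.card : ℕ) : ℝ) ≤ 2 * 10 ^ 35 * Λ ^ 6 * (1 + Real.log n) ^ 8 * (Real.log (8000 * Λ * ((n.factorial : ℝ) / (S.card * T.card : ℕ)))) ^ 2 * (n : ℝ) ^ (149 / 100 : ℝ) * B := by
  -- basic facts
  have hn1 : 1 ≤ n := by omega
  have hn2 : 2 ≤ n := by omega
  have hn0N : 0 < n := by omega
  have hnR : (40 : ℝ) ≤ n := by exact_mod_cast hn
  have hn0 : (0 : ℝ) < n := by linarith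
  have hn1R : (1 : ℝ) ≤ n := by linarith
  have hlog0 : 0 < Real.log n := Real.log_pos (by linarith)
  have hG1 : (1 : ℝ) ≤ 1 + Real.log n := by linarith
  have hG0 : (0 : ℝ) < 1 + Real.log n := by linarith
  have hΛ0 : 0 < Λ := by linarith
  have hB0 : (0 : ℝ) ≤ B := Nat.cast_nonneg _
  have hα0 : (0 : ℝ) < (S.card * T.card : ℕ) := by exact_mod_cast Nat.mul_pos hS0.card_pos hT0.card_pos
  have hf0 : (0 : ℝ) < n.factorial := by exact_mod_cast n.factorial_pos
  have hαle : ((S.card * T.card : ℕ) : ℝ) ≤ n.factorial := by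
    exact_mod_cast card_mul_card_le_factorial_of_injOn (injOn_quot_first hTPP hU0)
  have hKA1 : 1 ≤ ((n.factorial : ℝ) / (S.card * T.card : ℕ)) := by rw [le_div_iff₀ hα0]; linarith
  have hKB0 : 0 < ((n.factorial : ℝ) / (T.card * U.card : ℕ)) := by positivity
  have hKC0 : 0 < ((n.factorial : ℝ) / (U.card * S.card : ℕ)) := by positivity
  have hm3 : (((⌊Real.logb 2 ((n : ℝ) ^ 2)⌋₊ + 1 : ℕ) : ℝ)) ≤ 3 * (1 + Real.log n) := dyadicLevel_count n hn1
  have hm0 : (0 : ℝ) ≤ (((⌊Real.logb 2 ((n : ℝ) ^ 2)⌋₊ + 1 : ℕ) : ℝ)) := Nat.cast_nonneg _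
  have hθB0 : 0 < θB := lt_of_lt_of_le (by positivity) hθB
  have hθC0 : 0 < θC := lt_of_lt_of_le (by positivity) hθC
  have hdB1 : ∀ j k, dB j k ≤ 1 := fun j k => by rw [hdB]; exact pairDensity_le_one T U _
  have hdC1 : ∀ k i, dC k i ≤ 1 := fun k i => by rw [hdC]; exact pairDensity_le_one U S _
  have hdC0 : ∀ k i, 0 ≤ dC k i := fun k i => by rw [hdC]; positivity
  -- suppose there is no win: `W < N`
  by_contra hcon0
  obtain ⟨W, hWdef⟩ : ∃ W' : ℝ, W' = 2 * 10 ^ 35 * Λ ^ 6 * (1 + Real.log n) ^ 8 * (Real.log (8000 * Λ * ((n.factorial : ℝ) / (S.card * T.card : ℕ)))) ^ 2 * (n : ℝ) ^ (149 / 100 : ℝ) * B := ⟨_, rfl⟩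
  have hcon : W < ((S.card * T.card * U.card : ℕ) : ℝ) := by rw [hWdef]; exact lt_of_not_ge hcon0
  clear hcon0
  -- the parameters `ε₂ = 1/(2000Λ)`, `ε₁ = 1/(20000ΛG)`, `h₁ = 1/(80000ΛG²)`, `M = 56 m²`
  obtain ⟨ε₂, hε₂def⟩ : ∃ e : ℝ, e = (1 / (2000 * Λ)) := ⟨_, rfl⟩
  obtain ⟨ε₁, hε₁def⟩ : ∃ e : ℝ, e = (1 / (20000 * Λ * (1 + Real.log n))) := ⟨_, rfl⟩
  obtain ⟨h₁, hh₁def⟩ : ∃ e : ℝ, e = (1 / (80000 * Λ * (1 + Real.log n) ^ 2)) := ⟨_, rfl⟩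
  obtain ⟨M, hMdef⟩ : ∃ e : ℝ, e = 56 * ((((⌊Real.logb 2 ((n : ℝ) ^ 2)⌋₊ + 1 : ℕ) : ℝ)) * (((⌊Real.logb 2 ((n : ℝ) ^ 2)⌋₊ + 1 : ℕ) : ℝ))) := ⟨_, rfl⟩
  have hε₂0 : (0 : ℝ) < ε₂ := by rw [hε₂def]; positivity
  have hε₂1 : ε₂ ≤ 1 := by rw [hε₂def, div_le_one (by positivity)]; linarith
  have hε₁0 : (0 : ℝ) < ε₁ := by rw [hε₁def]; positivity
  have hε₁1 : ε₁ ≤ 1 := by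
    rw [hε₁def, div_le_one (by positivity)]; nlinarith
  have hh₁0 : (0 : ℝ) < h₁ := by rw [hh₁def]; positivity
  have hM : 56 * ((((⌊Real.logb 2 ((n : ℝ) ^ 2)⌋₊ + 1 : ℕ) : ℝ)) * (((⌊Real.logb 2 ((n : ℝ) ^ 2)⌋₊ + 1 : ℕ) : ℝ))) ≤ M := by rw [hMdef]
  -- the two spellings of `L_A`
  have hLAeq : 4 * ((n.factorial : ℝ) / (S.card * T.card : ℕ)) / ε₂ = 8000 * Λ * ((n.factorial : ℝ) / (S.card * T.card : ℕ)) := by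
    rw [hε₂def, div_div_eq_mul_div, div_one]; ring
  have hLA1 : 1 ≤ Real.log (4 * ((n.factorial : ℝ) / (S.card * T.card : ℕ)) / ε₂) := by
    rw [hLAeq, Real.le_log_iff_exp_le (by positivity)]
    have h3 : Real.exp 1 ≤ 3 := le_of_lt (lt_trans Real.exp_one_lt_d9 (by norm_num))
    have hΛ8 : (8000 : ℝ) ≤ 8000 * Λ := by linarith
    have h8 : (8000 : ℝ) * 1 ≤ 8000 * Λ * ((n.factorial : ℝ) / (S.card * T.card : ℕ)) :=
      mul_le_mul hΛ8 hKA1 zero_le_one (by positivity)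
    linarith only [h3, h8]
  -- `A₀` and `P`
  obtain ⟨A₀, hA₀def⟩ : ∃ A : ℝ, A = 2 * 10 ^ 10 * Λ ^ 2 * n * (1 + Real.log n) * Real.log (4 * ((n.factorial : ℝ) / (S.card * T.card : ℕ)) / ε₂) := ⟨_, rfl⟩
  have hA₀pos : 0 < A₀ := by rw [hA₀def]; positivity
  have hA₀ : 5000 * n * (1 + Real.log n) * Real.log (4 * ((n.factorial : ℝ) / (S.card * T.card : ℕ)) / ε₂) / ε₂ ^ 2 ≤ A₀ := by
    have e2 : ε₂ ^ 2 = 1 / (4000000 * Λ ^ 2) := by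
      rw [hε₂def, div_pow, one_pow, mul_pow]; norm_num
    rw [hA₀def, e2, div_div_eq_mul_div, div_one]; apply le_of_eq; ring
  have hA₀n : (n : ℝ) ≤ A₀ := by
    rw [hA₀def]
    have h1 : (1 : ℝ) ≤ Λ ^ 2 := one_le_pow₀ hΛ
    have h2 : (1 : ℝ) ≤ 2 * 10 ^ 10 * Λ ^ 2 := by linarith
    have h3 : (1 : ℝ) ≤ 2 * 10 ^ 10 * Λ ^ 2 * (1 + Real.log n) := one_le_mul_of_one_le_of_one_le h2 hG1
    have h4 : (1 : ℝ) ≤ 2 * 10 ^ 10 * Λ ^ 2 * (1 + Real.log n) * Real.log (4 * ((n.factorial : ℝ) / (S.card * T.card : ℕ)) / ε₂) :=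
      one_le_mul_of_one_le_of_one_le h3 hLA1
    calc (n : ℝ) = 1 * n := (one_mul _).symm
      _ ≤ (2 * 10 ^ 10 * Λ ^ 2 * (1 + Real.log n) * Real.log (4 * ((n.factorial : ℝ) / (S.card * T.card : ℕ)) / ε₂)) * n :=
          mul_le_mul_of_nonneg_right h4 hn0.le
      _ = _ := by ring
  have hA₀log : Real.log A₀ ≤ 101 / 100 * Real.log n := by rw [hA₀def, hLAeq]; exact hE1
  obtain ⟨P, hPdef⟩ : ∃ P' : ℝ, P' = A₀ ^ 2 * (n : ℝ) ^ (-(151 / 100 : ℝ)) / ε₁ ^ 2 := ⟨_, rfl⟩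
  have hP0 : 0 ≤ P := by
    rw [hPdef]; have := Real.rpow_pos_of_pos hn0 (-(151 / 100 : ℝ)); positivity
  have hPlow : A₀ ^ 2 * (n : ℝ) ^ (-(151 / 100 : ℝ)) ≤ P * ε₁ ^ 2 := by
    rw [hPdef, div_mul_cancel₀ _ (pow_ne_zero 2 hε₁0.ne')]
  -- the three win bounds are below the final bound `W`
  have hW : 10 ^ 7 * (1 + Real.log n) ^ 2 * (Real.log (4 * ((n.factorial : ℝ) / (S.card * T.card : ℕ)) / ε₂)) ^ 2 * n * B / (ε₂ ^ 4 * h₁ ^ 2) +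
      20 * (1 + M) * A₀ ^ 2 * B / (h₁ ^ 2 * n) + n * P * B ≤ W := by
    have h := hubAtoms_W_le (B := (B : ℝ)) hΛ hG1 hLA1 hn1R hB0 hm0 hm3
    have e : W = 2 * 10 ^ 35 * Λ ^ 6 * (1 + Real.log n) ^ 8 * (Real.log (4 * ((n.factorial : ℝ) / (S.card * T.card : ℕ)) / ε₂)) ^ 2 * (n : ℝ) ^ (149 / 100 : ℝ) * B := by
      rw [hWdef, hLAeq]
    rw [e, hPdef, hA₀def, hMdef, hh₁def, hε₁def]
    rw [hε₂def] at h ⊢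
    exact h
  -- the level data at each position, as opaque functions
  obtain ⟨σf, hσf⟩ : ∃ f : Fin n → Fin (⌊Real.logb 2 ((n : ℝ) ^ 2)⌋₊ + 1) → ℝ, ∀ k a, f k a = ∑ j ∈ Finset.univ.filter (fun j => θB ≤ dB j k ∧ ⌊Real.logb 2 (1 / dB j k)⌋₊ = a.val), pB j k := ⟨_, fun _ _ => rfl⟩
  obtain ⟨σ'f, hσ'f⟩ : ∃ f : Fin n → Fin (⌊Real.logb 2 ((n : ℝ) ^ 2)⌋₊ + 1) → ℝ, ∀ k a, f k a = ∑ j ∈ Finset.univ.filter (fun j => θB ≤ dB j k ∧ ⌊Real.logb 2 (1 / dB j k)⌋₊ = a.val), dB j k := ⟨_, fun _ _ => rfl⟩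
  obtain ⟨xf, hxf⟩ : ∃ f : Fin n → Fin (⌊Real.logb 2 ((n : ℝ) ^ 2)⌋₊ + 1) → ℝ, ∀ k a, f k a = max (((Finset.univ.filter (fun j => θB ≤ dB j k ∧ ⌊Real.logb 2 (1 / dB j k)⌋₊ = a.val)).card : ℝ)) 1 := ⟨_, fun _ _ => rfl⟩
  obtain ⟨ρf, hρf⟩ : ∃ f : Fin n → Fin (⌊Real.logb 2 ((n : ℝ) ^ 2)⌋₊ + 1) → ℝ, ∀ k b, f k b = ∑ i ∈ Finset.univ.filter (fun i => θC ≤ dC k i ∧ ⌊Real.logb 2 (1 / dC k i)⌋₊ = b.val), pC k i := ⟨_, fun _ _ => rfl⟩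
  obtain ⟨ρ'f, hρ'f⟩ : ∃ f : Fin n → Fin (⌊Real.logb 2 ((n : ℝ) ^ 2)⌋₊ + 1) → ℝ, ∀ k b, f k b = ∑ i ∈ Finset.univ.filter (fun i => θC ≤ dC k i ∧ ⌊Real.logb 2 (1 / dC k i)⌋₊ = b.val), dC k i := ⟨_, fun _ _ => rfl⟩
  obtain ⟨yf, hyf⟩ : ∃ f : Fin n → Fin (⌊Real.logb 2 ((n : ℝ) ^ 2)⌋₊ + 1) → ℝ, ∀ k b, f k b = max (((Finset.univ.filter (fun i => θC ≤ dC k i ∧ ⌊Real.logb 2 (1 / dC k i)⌋₊ = b.val)).card : ℝ)) 1 := ⟨_, fun _ _ => rfl⟩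
  obtain ⟨Ψf, hΨf⟩ : ∃ f : Fin n → Fin (⌊Real.logb 2 ((n : ℝ) ^ 2)⌋₊ + 1) → Fin (⌊Real.logb 2 ((n : ℝ) ^ 2)⌋₊ + 1) → ℝ, ∀ k a b, f k a b =
      ∑ i ∈ Finset.univ.filter (fun i => θC ≤ dC k i ∧ ⌊Real.logb 2 (1 / dC k i)⌋₊ = b.val), ∑ j ∈ Finset.univ.filter (fun j => θB ≤ dB j k ∧ ⌊Real.logb 2 (1 / dB j k)⌋₊ = a.val), dA i j * pB j k * pC k i := ⟨_, fun _ _ _ => rfl⟩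
  -- elementary comparisons of the level masses
  have hσcmp : ∀ k a, 0 ≤ σf k a ∧ σf k a ≤ σ'f k a ∧ 15 / 16 * σ'f k a ≤ σf k a := by
    intro k a; rw [hσf, hσ'f]
    exact level_sums_cmp hn0N (fun j => dB j k) (fun j => pB j k) θB hθB (fun j => hpB j k) a.val
  have hρcmp : ∀ k b, 0 ≤ ρf k b ∧ ρf k b ≤ ρ'f k b ∧ 15 / 16 * ρ'f k b ≤ ρf k b := by
    intro k b; rw [hρf, hρ'f]
    exact level_sums_cmp hn0N (fun i => dC k i) (fun i => pC k i) θC hθC (fun i => hpC k i) b.val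
  have hσ'0 : ∀ k a, 0 ≤ σ'f k a := fun k a => (hσcmp k a).1.trans (hσcmp k a).2.1
  have hρ'0 : ∀ k b, 0 ≤ ρ'f k b := fun k b => (hρcmp k b).1.trans (hρcmp k b).2.1
  -- the heavy masses by position
  have hSX : ∀ k, (∑ a, σ'f k a) = ∑ j, (if θB ≤ dB j k then dB j k else 0) := by
    intro k; simp only [hσ'f]
    exact hubAtoms_sum_levels_heavy hn1 (fun j => dB j k) θB hθB (fun j => hdB1 j k)
  have hSY : ∀ k, (∑ b, ρ'f k b) = ∑ i, (if θC ≤ dC k i then dC k i else 0) := by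
    intro k; simp only [hρ'f]
    exact hubAtoms_sum_levels_heavy hn1 (fun i => dC k i) θC hθC (fun i => hdC1 k i)
  have hSXsum : ∑ k, (∑ a, σ'f k a) ≤ Λ := by
    simp only [hSX]; rw [Finset.sum_comm]; exact hmassB
  have hSYsum : ∑ k, (∑ b, ρ'f k b) ≤ Λ := by
    simp only [hSY]; exact hmassC
  have hSX0 : ∀ k, 0 ≤ (∑ a, σ'f k a) := fun k => Finset.sum_nonneg fun a _ => hσ'0 k a
  have hSY1 : ∀ k, (∑ b, ρ'f k b) ≤ 1 := by
    intro k; simp only [hρ'f]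
    exact hubAtoms_sum_levels_le_one hn1 (fun i => dC k i) θC hθC (fun i => hdC0 k i)
      (fun i => hdC1 k i) (hubAtoms_rowsum_eq_one U S hU0 hS0 dC hdC k)
  -- the per-position inequality and the rate box, at every position
  have hpos : ∀ k, ((n : ℝ) - 1) * ((∑ j : Fin n, pB j k) * (∑ i : Fin n, pC k i) / n - ∑ i : Fin n, ∑ j : Fin n, dA i j * pB j k * pC k i) ≤ 74 / 100 * ((∑ a, if ε₁ ≤ σf k a ∧ ∃ b, ε₁ ≤ ρf k b ∧ Ψf k a b ≤ (1 - ε₂) * (σf k a * ρf k b) / n then σ'f k a * (1 - Real.log (xf k a) / Real.log n) else 0) + (∑ b, if ε₁ ≤ ρf k b ∧ ∃ a, ε₁ ≤ σf k a ∧ Ψf k a b ≤ (1 - ε₂) * (σf k a * ρf k b) / n then ρ'f k b * (1 - Real.log (yf k b) / Real.log n) else 0)) + (ε₂ * ((∑ a, σ'f k a) * (∑ b, ρ'f k b)) + 2 * ε₁ * (((⌊Real.logb 2 ((n : ℝ) ^ 2)⌋₊ + 1 : ℕ) : ℝ)) * ((∑ a, σ'f k a) + (∑ b, ρ'f k b))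 + 2 * ((∑ a, σ'f k a) + (∑ b, ρ'f k b)) * (((((⌊Real.logb 2 ((n : ℝ) ^ 2)⌋₊ + 1 : ℕ) : ℝ)) * (((⌊Real.logb 2 ((n : ℝ) ^ 2)⌋₊ + 1 : ℕ) : ℝ))) * h₁)) := fun k =>
    position_kept_bound_inst hn2 B hB hTPP hS0 hT0 hU0 dA dB dC pB pC hdA hdB hdC θB θC hθB hθC hpB hpC
      ε₁ ε₂ h₁ M A₀ P W hε₁0 hε₂0 hε₂1 hh₁0 hP0 hM hA₀ hA₀n hA₀log hPlow hW hcon k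
      (σf k) (σ'f k) (xf k) (ρf k) (ρ'f k) (yf k) (hσf k) (hσ'f k) (hxf k) (hρf k) (hρ'f k) (hyf k)
      (Ψf k) (hΨf k)
  have hrate := fun k =>
    incl_rate_bounds hn2 B hB hTPP hS0 hT0 hU0 dA dB dC pB pC hdA hdB hdC θB θC hθB hθC hpB hpC
      ε₁ ε₂ h₁ M A₀ P W hε₁0 hε₂0 hε₂1 hh₁0 hP0 hM hA₀ hA₀n hA₀log hPlow hW hcon k
      (σf k) (σ'f k) (xf k) (ρf k) (ρ'f k) (yf k) (hσf k) (hσ'f k) (hxf k) (hρf k) (hρ'f k) (hyf k)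
      (Ψf k) (hΨf k)
  -- summing the left-hand sides gives the kept mass
  have hsumL : ∑ k : Fin n, ((n : ℝ) - 1) * ((∑ j : Fin n, pB j k) * (∑ i : Fin n, pC k i) / n - ∑ i : Fin n, ∑ j : Fin n, dA i j * pB j k * pC k i) =
      -((n : ℝ) - 1) * ∑ i : Fin n, ∑ j : Fin n, ∑ k : Fin n, (dA i j - 1 / n) * pB j k * pC k i := by
    rw [tripleSum_by_position, ← Finset.mul_sum, neg_mul, ← mul_neg, ← Finset.sum_neg_distrib]
    congr 1
    refine Finset.sum_congr rfl fun k _ => ?_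
    ring
  have hsumR : ∑ k : Fin n, ((n : ℝ) - 1) * ((∑ j : Fin n, pB j k) * (∑ i : Fin n, pC k i) / n - ∑ i : Fin n, ∑ j : Fin n, dA i j * pB j k * pC k i) ≤ ∑ k : Fin n, (74 / 100 * ((∑ a, if ε₁ ≤ σf k a ∧ ∃ b, ε₁ ≤ ρf k b ∧ Ψf k a b ≤ (1 - ε₂) * (σf k a * ρf k b) / n then σ'f k a * (1 - Real.log (xf k a) / Real.log n) else 0) + (∑ b, if ε₁ ≤ ρf k b ∧ ∃ a, ε₁ ≤ σf k a ∧ Ψf k a b ≤ (1 - ε₂) * (σf k a * ρf k b) / n then ρ'f k b * (1 - Real.log (yf k b) / Real.log n) else 0)) + (ε₂ * ((∑ a, σ'f k a) * (∑ b, ρ'f k b)) + 2 * ε₁ * (((⌊Real.logb 2 ((n : ℝ) ^ 2)⌋₊ + 1 : ℕ) : ℝ)) * ((∑ a, σ'f k a) + (∑ b, ρ'f k b)) + 2 * ((∑ a, σ'f k a) + (∑ b, ρ'f k b)) * (((((⌊Real.logb 2 ((n : ℝ) ^ 2)⌋₊ + 1 : ℕ) : ℝ)) * (((⌊Real.logb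 2 ((n : ℝ) ^ 2)⌋₊ + 1 : ℕ) : ℝ))) * h₁))) :=
    Finset.sum_le_sum fun k _ => hpos k
  -- the slop
  have hslopk : ∀ k, (ε₂ * ((∑ a, σ'f k a) * (∑ b, ρ'f k b)) + 2 * ε₁ * (((⌊Real.logb 2 ((n : ℝ) ^ 2)⌋₊ + 1 : ℕ) : ℝ)) * ((∑ a, σ'f k a) + (∑ b, ρ'f k b)) + 2 * ((∑ a, σ'f k a) + (∑ b, ρ'f k b)) * (((((⌊Real.logb 2 ((n : ℝ) ^ 2)⌋₊ + 1 : ℕ) : ℝ)) * (((⌊Real.logb 2 ((n : ℝ) ^ 2)⌋₊ + 1 : ℕ) : ℝ))) * h₁)) ≤ ε₂ * (∑ a, σ'f k a) +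
      (2 * ε₁ * (((⌊Real.logb 2 ((n : ℝ) ^ 2)⌋₊ + 1 : ℕ) : ℝ)) + 2 * (((((⌊Real.logb 2 ((n : ℝ) ^ 2)⌋₊ + 1 : ℕ) : ℝ)) * (((⌊Real.logb 2 ((n : ℝ) ^ 2)⌋₊ + 1 : ℕ) : ℝ))) * h₁)) * ((∑ a, σ'f k a) + (∑ b, ρ'f k b)) := by
    intro k
    have h1 := mul_le_mul_of_nonneg_left (hSY1 k) (hSX0 k)
    rw [mul_one] at h1
    have h2 := mul_le_mul_of_nonneg_left h1 hε₂0.le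
    have h3 := add_le_add_right h2
      ((2 * ε₁ * (((⌊Real.logb 2 ((n : ℝ) ^ 2)⌋₊ + 1 : ℕ) : ℝ)) + 2 * (((((⌊Real.logb 2 ((n : ℝ) ^ 2)⌋₊ + 1 : ℕ) : ℝ)) * (((⌊Real.logb 2 ((n : ℝ) ^ 2)⌋₊ + 1 : ℕ) : ℝ))) * h₁)) * ((∑ a, σ'f k a) + (∑ b, ρ'f k b)))
    refine le_trans (le_of_eq ?_) (le_trans h3 (le_of_eq ?_))
    · ring
    · ring
  have hslop : ∑ k : Fin n, (ε₂ * ((∑ a, σ'f k a) * (∑ b, ρ'f k b)) + 2 * ε₁ * (((⌊Real.logb 2 ((n : ℝ) ^ 2)⌋₊ + 1 : ℕ) : ℝ)) * ((∑ a, σ'f k a) + (∑ b, ρ'f k b)) + 2 * ((∑ a, σ'f k a) + (∑ b, ρ'f k b)) * (((((⌊Real.logb 2 ((n : ℝ) ^ 2)⌋₊ + 1 : ℕ) : ℝ)) * (((⌊Real.logb 2 ((n : ℝ) ^ 2)⌋₊ + 1 : ℕ) : ℝ))) * h₁)) ≤ 155 / 100000 := by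
    refine (Finset.sum_le_sum fun k _ => hslopk k).trans ?_
    rw [Finset.sum_add_distrib, ← Finset.mul_sum, ← Finset.mul_sum, Finset.sum_add_distrib]
    have hc0 : 0 ≤ 2 * ε₁ * (((⌊Real.logb 2 ((n : ℝ) ^ 2)⌋₊ + 1 : ℕ) : ℝ)) + 2 * (((((⌊Real.logb 2 ((n : ℝ) ^ 2)⌋₊ + 1 : ℕ) : ℝ)) * (((⌊Real.logb 2 ((n : ℝ) ^ 2)⌋₊ + 1 : ℕ) : ℝ))) * h₁) := by positivity
    have h1 := mul_le_mul_of_nonneg_left hSXsum hε₂0.le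
    have h2 := mul_le_mul_of_nonneg_left (add_le_add hSXsum hSYsum) hc0
    have h3 := hubAtoms_slop_le hΛ0 hG1 hm0 hm3
    rw [← hε₂def, ← hε₁def, ← hh₁def] at h3
    refine (add_le_add h1 h2).trans (le_trans (le_of_eq ?_) h3)
    ring
  -- the included levels on the `B` side and their certificate
  obtain ⟨IncB, hIncB⟩ : ∃ I : Finset (Fin n × Fin (⌊Real.logb 2 ((n : ℝ) ^ 2)⌋₊ + 1)), I = Finset.univ.filter (fun p => ε₁ ≤ σf p.1 p.2 ∧ ∃ b, ε₁ ≤ ρf p.1 b ∧ Ψf p.1 p.2 b ≤ (1 - ε₂) * (σf p.1 p.2 * ρf p.1 b) / n) := ⟨_, rfl⟩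
  have hmemB : ∀ p, p ∈ IncB ↔ (ε₁ ≤ σf p.1 p.2 ∧ ∃ b, ε₁ ≤ ρf p.1 b ∧ Ψf p.1 p.2 b ≤ (1 - ε₂) * (σf p.1 p.2 * ρf p.1 b) / n) := fun p => by
    rw [hIncB, Finset.mem_filter]; simp only [Finset.mem_univ, true_and]
  have hCA : ∑ k : Fin n, (∑ a, if ε₁ ≤ σf k a ∧ ∃ b, ε₁ ≤ ρf k b ∧ Ψf k a b ≤ (1 - ε₂) * (σf k a * ρf k b) / n then σ'f k a * (1 - Real.log (xf k a) / Real.log n) else 0) =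
      (∑ p ∈ IncB, σ'f p.1 p.2 * (Real.log n - Real.log (xf p.1 p.2))) / Real.log n := by
    rw [Finset.sum_div, hIncB, Finset.sum_filter, ← Finset.univ_product_univ, Finset.sum_product]
    refine Finset.sum_congr rfl fun k _ => Finset.sum_congr rfl fun a _ => ?_
    split_ifs
    · rw [mul_div_assoc, sub_div, div_self hlog0.ne']
    · simp
  have hsB0 : 0 ≤ ∑ p ∈ IncB, σ'f p.1 p.2 := Finset.sum_nonneg fun p _ => hσ'0 p.1 p.2
  have hsBall : ∑ p ∈ IncB, σ'f p.1 p.2 ≤ ∑ k : Fin n, (∑ a, σ'f k a) := by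
    calc ∑ p ∈ IncB, σ'f p.1 p.2 ≤ ∑ p ∈ (Finset.univ : Finset (Fin n × Fin (⌊Real.logb 2 ((n : ℝ) ^ 2)⌋₊ + 1))), σ'f p.1 p.2 :=
          Finset.sum_le_sum_of_subset_of_nonneg (by rw [hIncB]; exact Finset.filter_subset _ _)
            fun p _ _ => hσ'0 p.1 p.2
      _ = ∑ k : Fin n, (∑ a, σ'f k a) := by rw [← Finset.univ_product_univ, Finset.sum_product]
  have hsBΛ : ∑ p ∈ IncB, σ'f p.1 p.2 ≤ Λ := hsBall.trans hSXsum
  have hrateB : 245 / 1000 * Real.log n * ∑ p ∈ IncB, σ'f p.1 p.2 ≤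
      ∑ p ∈ IncB, σ'f p.1 p.2 * (Real.log n - Real.log (xf p.1 p.2)) := by
    rw [Finset.mul_sum]
    refine Finset.sum_le_sum fun p hp => ?_
    have hx := ((hrate p.1).1 p.2 ((hmemB p).1 hp)).2
    have h0 := hσ'0 p.1 p.2
    have h3 : 245 / 1000 * Real.log n ≤ Real.log n - Real.log (xf p.1 p.2) := by linarith only [hx]
    rw [mul_comm]
    exact mul_le_mul_of_nonneg_left h3 h0
  have hcardB : 2 * (((IncB.image Prod.fst).card : ℕ) : ℝ) ^ 2 ≤ n := by
    have h1 : ((IncB.image Prod.fst).card : ℝ) ≤ IncB.card := by exact_mod_cast Finset.card_image_le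
    have h2 : (IncB.card : ℝ) * ε₁ ≤ ∑ p ∈ IncB, σ'f p.1 p.2 := by
      rw [← nsmul_eq_mul, ← Finset.sum_const]
      refine Finset.sum_le_sum fun p hp => ?_
      exact ((hmemB p).1 hp).1.trans (hσcmp p.1 p.2).2.1
    have h3 : (IncB.card : ℝ) ≤ 20000 * Λ ^ 2 * (1 + Real.log n) := by
      have h4 : (IncB.card : ℝ) * ε₁ ≤ Λ := h2.trans hsBΛ
      rw [hε₁def, mul_one_div, div_le_iff₀ (by positivity)] at h4
      exact h4.trans_eq (by ring)
    have h0 : (0 : ℝ) ≤ (IncB.image Prod.fst).card := Nat.cast_nonneg _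
    have h5 : ((IncB.image Prod.fst).card : ℝ) ≤ 20000 * Λ ^ 2 * (1 + Real.log n) := h1.trans h3
    have h6 := mul_le_mul h5 h5 h0 (by positivity)
    linarith only [h6, hE3]
  have hcertB := certificate_levels hn2 T U hT0 hU0 (injOn_quot_second hTPP hS0) dB hdB θB hθB0 IncB ε₁ hε₁0
    (fun p hp => by rw [← hσ'f]; exact ((hmemB p).1 hp).1.trans (hσcmp p.1 p.2).2.1) hcardB
  simp only [← hσ'f, ← hxf] at hcertB
  -- the included levels on the `C` side and their certificate
  obtain ⟨IncC, hIncC⟩ : ∃ I : Finset (Fin n × Fin (⌊Real.logb 2 ((n : ℝ) ^ 2)⌋₊ + 1)), I = Finset.univ.filter (fun p => ε₁ ≤ ρf p.1 p.2 ∧ ∃ a, ε₁ ≤ σf p.1 a ∧ Ψf p.1 a p.2 ≤ (1 - ε₂) * (σf p.1 a * ρf p.1 p.2) / n) := ⟨_, rfl⟩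
  have hmemC : ∀ p, p ∈ IncC ↔ (ε₁ ≤ ρf p.1 p.2 ∧ ∃ a, ε₁ ≤ σf p.1 a ∧ Ψf p.1 a p.2 ≤ (1 - ε₂) * (σf p.1 a * ρf p.1 p.2) / n) := fun p => by
    rw [hIncC, Finset.mem_filter]; simp only [Finset.mem_univ, true_and]
  have hCB : ∑ k : Fin n, (∑ b, if ε₁ ≤ ρf k b ∧ ∃ a, ε₁ ≤ σf k a ∧ Ψf k a b ≤ (1 - ε₂) * (σf k a * ρf k b) / n then ρ'f k b * (1 - Real.log (yf k b) / Real.log n) else 0) =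
      (∑ p ∈ IncC, ρ'f p.1 p.2 * (Real.log n - Real.log (yf p.1 p.2))) / Real.log n := by
    rw [Finset.sum_div, hIncC, Finset.sum_filter, ← Finset.univ_product_univ, Finset.sum_product]
    refine Finset.sum_congr rfl fun k _ => Finset.sum_congr rfl fun b _ => ?_
    split_ifs
    · rw [mul_div_assoc, sub_div, div_self hlog0.ne']
    · simp
  have hsC0 : 0 ≤ ∑ p ∈ IncC, ρ'f p.1 p.2 := Finset.sum_nonneg fun p _ => hρ'0 p.1 p.2
  have hsCall : ∑ p ∈ IncC, ρ'f p.1 p.2 ≤ ∑ k : Fin n, (∑ b, ρ'f k b) := by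
    calc ∑ p ∈ IncC, ρ'f p.1 p.2 ≤ ∑ p ∈ (Finset.univ : Finset (Fin n × Fin (⌊Real.logb 2 ((n : ℝ) ^ 2)⌋₊ + 1))), ρ'f p.1 p.2 :=
          Finset.sum_le_sum_of_subset_of_nonneg (by rw [hIncC]; exact Finset.filter_subset _ _)
            fun p _ _ => hρ'0 p.1 p.2
      _ = ∑ k : Fin n, (∑ b, ρ'f k b) := by rw [← Finset.univ_product_univ, Finset.sum_product]
  have hsCΛ : ∑ p ∈ IncC, ρ'f p.1 p.2 ≤ Λ := hsCall.trans hSYsum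
  have hrateC : 245 / 1000 * Real.log n * ∑ p ∈ IncC, ρ'f p.1 p.2 ≤
      ∑ p ∈ IncC, ρ'f p.1 p.2 * (Real.log n - Real.log (yf p.1 p.2)) := by
    rw [Finset.mul_sum]
    refine Finset.sum_le_sum fun p hp => ?_
    have hy := ((hrate p.1).2 p.2 ((hmemC p).1 hp)).2
    have h0 := hρ'0 p.1 p.2
    have h3 : 245 / 1000 * Real.log n ≤ Real.log n - Real.log (yf p.1 p.2) := by linarith only [hy]
    rw [mul_comm]
    exact mul_le_mul_of_nonneg_left h3 h0
  have hcardC : 2 * (((IncC.image Prod.fst).card : ℕ) : ℝ) ^ 2 ≤ n := by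
    have h1 : ((IncC.image Prod.fst).card : ℝ) ≤ IncC.card := by exact_mod_cast Finset.card_image_le
    have h2 : (IncC.card : ℝ) * ε₁ ≤ ∑ p ∈ IncC, ρ'f p.1 p.2 := by
      rw [← nsmul_eq_mul, ← Finset.sum_const]
      refine Finset.sum_le_sum fun p hp => ?_
      exact ((hmemC p).1 hp).1.trans (hρcmp p.1 p.2).2.1
    have h3 : (IncC.card : ℝ) ≤ 20000 * Λ ^ 2 * (1 + Real.log n) := by
      have h4 : (IncC.card : ℝ) * ε₁ ≤ Λ := h2.trans hsCΛ
      rw [hε₁def, mul_one_div, div_le_iff₀ (by positivity)] at h4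
      exact h4.trans_eq (by ring)
    have h0 : (0 : ℝ) ≤ (IncC.image Prod.fst).card := Nat.cast_nonneg _
    have h5 : ((IncC.image Prod.fst).card : ℝ) ≤ 20000 * Λ ^ 2 * (1 + Real.log n) := h1.trans h3
    have h6 := mul_le_mul h5 h5 h0 (by positivity)
    linarith only [h6, hE3]
  have hcertC := certificate_levels hn2 S U hS0 hU0 (injOn_quot_outer hTPP hT0) (fun i k => dC k i)
    (fun i j => hubAtoms_profile_swap U S dC hdC i j) θC hθC0 IncC ε₁ hε₁0
    (fun p hp => by rw [← hρ'f]; exact ((hmemC p).1 hp).1.trans (hρcmp p.1 p.2).2.1) hcardC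
  simp only [← hρ'f, ← hyf] at hcertC
  have hKCeq : (n.factorial : ℝ) / (S.card * U.card : ℕ) = ((n.factorial : ℝ) / (U.card * S.card : ℕ)) := by rw [Nat.mul_comm]
  rw [hKCeq] at hcertC
  -- the co-density cap
  have hQ' : Real.log ((n.factorial : ℝ) / (T.card * U.card : ℕ)) + Real.log ((n.factorial : ℝ) / (U.card * S.card : ℕ)) ≤ 134 / 100 * Real.log n := by
    rw [← Real.log_mul hKB0.ne' hKC0.ne']; exact hQ
  -- the endgame
  have hLg : 20 ≤ Real.log n := by
    refine hubAtoms_twenty_le_log (le_trans ?_ hE3)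
    have h1 : (1 : ℝ) ≤ Λ ^ 4 := one_le_pow₀ hΛ
    have h2 : (1 : ℝ) ≤ (1 + Real.log n) ^ 2 := one_le_pow₀ hG1
    have h3 := one_le_mul_of_one_le_of_one_le h1 h2
    linarith only [h3]
  have hE4' : 16 * Real.log (8 / ε₁) + 4 ≤ 5 / 1000 * Real.log n := by
    have e : 8 / ε₁ = 160000 * Λ * (1 + Real.log n) := by
      rw [hε₁def, div_div_eq_mul_div, div_one]; ring
    rw [e]; exact hE4
  have hE5' : Real.log (Λ / ε₁) ≤ 45 / 1000 * Real.log n := by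
    have e : Λ / ε₁ = 20000 * Λ ^ 2 * (1 + Real.log n) := by
      rw [hε₁def, div_div_eq_mul_div, div_one]; ring
    rw [e]
    refine le_trans (Real.log_le_log (by positivity) ?_) hE5
    have h0 : 0 ≤ Λ ^ 2 * (1 + Real.log n) := by positivity
    linarith only [h0]
  have hkept' : 1 - δ ≤ 74 / 100 * (((∑ p ∈ IncB, σ'f p.1 p.2 * (Real.log n - Real.log (xf p.1 p.2))) +
      (∑ p ∈ IncC, ρ'f p.1 p.2 * (Real.log n - Real.log (yf p.1 p.2)))) / Real.log n) +
      ∑ k : Fin n, (ε₂ * ((∑ a, σ'f k a) * (∑ b, ρ'f k b)) + 2 * ε₁ * (((⌊Real.logb 2 ((n : ℝ) ^ 2)⌋₊ + 1 : ℕ) : ℝ)) * ((∑ a, σ'f k a) + (∑ b, ρ'f k b)) + 2 * ((∑ a, σ'f k a) + (∑ b, ρ'f k b)) * (((((⌊Real.logb 2 ((n : ℝ) ^ 2)⌋₊ + 1 : ℕ) : ℝ)) * (((⌊Real.logb 2 ((n : ℝ) ^ 2)⌋₊ + 1 : ℕ) : ℝ))) * h₁)) := by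
    have h := hkept.trans (hsumL ▸ hsumR)
    rw [Finset.sum_add_distrib, ← Finset.mul_sum, Finset.sum_add_distrib, hCA, hCB, ← add_div] at h
    exact h
  exact hubAtoms_endgame hLg hε₁0 (by linarith only [hε₁1]) hE4' hE5' hsB0 hsC0 hsBΛ hsCΛ hrateB hrateC hcertB hcertC hQ' hδ
    hslop hkept'

end Summit.MatrixMultiplication.MatrixMultiplication.Theorems.PolynomialSlack
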